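import Mathlib
import HarnessLib
import HarnessLib.Audit
import Summits.Parity.Statement
import Literature.NumberTheory.Sieve.SingularSeries
import Summits.Parity.GeneralizedHardyLittlewood.Theorems.LeeYangFibresFibrationLemmaFinal
import HarnessLib.Audit.Status.Attr

/-!
Route: DeterminantMoebiusCores

DORMANT since 2026-08-24T05:53:55Z (reconciler: no traction for 6.6 d (last activity item-evidence-added at 2026-08-17T15:38:54Z); parked, not closed — `ledger route dormant route-Parity-DeterminantMoebiusCores --off` to reactivate) — unstaffed, not closed; items shared with open routes are served there. `ledger route dormant <id> --off` reactivates.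

# Route DeterminantMoebiusCores — full Möbius opening — Dickson–Hardy–Littlewood is
Bombieri–Vinogradov plus pure-Möbius k-point cores on {d·e = ψ_i(n)}, then the fibration lemma

It suffices to show X = PairCores ∧ HigherCores (card determinant-moebius-core; conforming gen-2
re-route of route-Parity-DeterminantMoebius, whose assembly stopped at PairsHL). Open EVERY von
Mangoldt factor of a one-dimensional system Ψ = (ψ_1,…,ψ_t), ψ_i(n) = a_i n + b_i: Λ = Λ♭ + Λ♯ with
Λ♭_P(m) = Σ_{d|m, d≤P} μ(d) log(m/d) and Λ♯_P(m) = Σ_{d|m, d>P} μ(d) log(m/d) (Möbius on the LONG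
variable of the determinant-type variety d·e = ψ_i(n)), P = N^θ. Then Σ_{n∈K} Π_i Λ(ψ_i(n)) =
Σ_{A⊆[t]} T_A with Λ♯ exactly on the factors in A. Take θ < 1/(2(t−1)): T_∅ is an elementary lattice
count plus a truncated singular series; each T_{i} is ONE prime in progressions of modulus ≤
L·N^{(t−1)θ} < N^{1/2} — Bombieri–Vinogradov, PROVED in the tree — and the |A| ≤ 1 main terms add up
to t·𝔖β_∞ − (t−1)·𝔖β_∞ = 𝔖β_∞ (t = 2: the card's 𝔖+𝔖−𝔖, refuter-checked); prime TUPLES in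
progressions never occur because at most one Λ♯ is ever closed back into Λ. What is left, for |A| =
k ≥ 2, are k-point correlations of Λ♯ along the k dilated progressions n ↦ ψ_i(n)/e_i in residue
classes to moduli ≤ N^{(t−k)θ} (from the Λ♭ factors): PairCores (k = 2, rank 2) and HigherCores (k ≥
3, rank 3) say exactly that these have divisor-weighted level ν with (log N)^{−A} savings whenever ν
+ θ < 1/2, uniformly over non-degenerate systems of size ≤ L (Green–Tao normalisation: shifts |b_i|
≤ LN, convex K ⊆ [−N,N]) — ON TAME CLASSES ONLY (rev 2–3 repair after the crux attacks
refuter-rattack-stmt-Parity-14636/14637, refuted-misstated: a class forcing a prime > N^θ, or a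
block of primes with product > N^θ, into some ψ_i carries a first-order main term because there Λ♯ =
−Λ♭; tame = whole shared part gcd(ψ_i(r_q), q) ≤ N^{θ/2}, rendered as an indicator inside the q-sum;
the reduction only ever needs tame classes after discarding an n-set of mass O(N^{1−θ/(2t)+o(1)})).
OpeningReduction (crux, ranked after the cores: the route's own XL bookkeeping, already holed once)
is this bookkeeping, PairCores → HigherCores → [Dickson–Hardy–Littlewood at d = 1, the statement of
the shared item DimOne/stmt-Parity-0819 INLINED verbatim] (re-badge repair 2026-08-17: DimOne and
FibrationLemma are no longer ITEMS of this route — DimOne is summit-equivalent by the landed iffs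
EngineToGHL.generalizedHardyLittlewood_iff_dimOne / AbsoluteUpgrade.summit_iff_dimOne and its only
registered skeleton hides the summit (stub_twoFlatFactors ⟺ GHL, DicksonFibrationDimOneEquivalence),
so a route may carry it as a waypoint inside a bridge, never as a staffable item; the fibration
lemma is a THEOREM of the tree and is invoked by name in `closes`). TwinCores (support since the
2026-08-17 re-badge; the card's own instance Ψ = (n, n+h), ν = 0, P = x^{1/2−ε} — CENTRE + CORE of
the retired route) with TwinReduction: TwinCores → PairsHL (BV + 𝔖+𝔖−𝔖) and CoresToTwin: PairCores →
TwinCores record that HL(h) ⟺ TwinCores(h) unconditionally: the banked test-bed of the line, not a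
hypothesis of `closes`.
Lean: `PairCores ∧ HigherCores`

## Assembly
The deciding theorem is `closes (hP : PairCores) (hH : HigherCores) (hR : OpeningReduction) :
GeneralizedHardyLittlewood := Theorems.FibrationGlue.generalizedHardyLittlewood_of_dimOne (hR hP
hH)` (2026-08-17, certified native): the two staffing cruxes, the route's own opening bookkeeping
down to d = 1, and the PROVED Theses-free fibration lemma (Green–Tao's 'hold d − 1 variables fixed',
4.6 kLOC, Theorems/LeeYangFibresFibrationLemma*.lean, axioms standard) — so the proved piece is
load-bearing in `closes` itself and no summit-equivalent statement is an item. The `Assembly` ITEM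
(rank 1, PairCores → HigherCores → GeneralizedHardyLittlewood, restated at rev 5 from the rev-1
tautology) is the same obligation as OpeningReduction modulo that theorem: `example (h :
OpeningReduction) : Assembly := fun hP hH =>
Theorems.FibrationGlue.generalizedHardyLittlewood_of_dimOne (h hP hH)` (checked rc 0 in the
planner's Sketch.lean), and conversely via EngineToGHL.dimOne_of_generalizedHardyLittlewood; provers
prove OpeningReduction (registered skeleton Cruxes/OpeningReduction/Lines/birth.lean: stub_flatTerm,
stub_onePrimeTerms, stub_coreTerms, composition kernel-checked) and close Assembly in one line.
TwinCores, TwinReduction, CoresToTwin are carried as support (the twin test-bed) but are not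
hypotheses of `closes`.

Rationale: WHY THIS LINE. The card's double opening made Hardy–Littlewood PAIRS equivalent, unconditionally, to
Möbius randomness on the lines of {BC − MN = h} (Bombieri–Vinogradov for the lopsided regimes,
Duke–Friedlander–Iwaniec Kloosterman fractions available at the balanced centre, SawinShusterman2018
§6 as the 𝔽_q[T] template where the architecture is a theorem); the gen-2 step is that opening ALL t
factors at a small truncation θ < 1/(2(t−1)) lifts this to every one-dimensional system WITHOUT ever
meeting prime tuples in progressions — the obstruction that forces one-sided openings
(SawinShusterman2018 Thm 6.3, MurtyVatwani2017, retired route MobiusShiftedPrimes) to levels beyond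
1/2 or to a tuple Bombieri–Vinogradov theorem nobody has: every mixed term contains at most one
genuine prime and is Bombieri–Vinogradov
(Literature.NumberTheory.Sieve.BombieriVinogradovStatement_holds, proved) plus Goldston–Yıldırım
truncated-singular-series asymptotics (arXiv:math/0111212, GoldstonPintzYildirim2009), whose known
boundary is precisely 'one prime is a theorem, two primes are Hardy–Littlewood'. So
Dickson–Hardy–Littlewood at d = 1 becomes EQUIVALENT to a family of pure-Möbius core statements and
reaches the sub-problem Statement through the fibration lemma (GreenTao2010 p.6) — now a THEOREM of
the tree (Theorems.FibrationGlue.generalizedHardyLittlewood_of_dimOne, Theses-free, 4.6 kLOC)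
invoked by name in `closes` — with no conjecture-strength level hypothesis. The architecture itself
was VINDICATED in the tree on 2026-08-17 in Green–Tao's sieve model (lead
prover-line-stmt-Parity-0819-c2 on the sibling bridge DicksonFibration): with Λ♯ = Λ_{ℤ/P_N} the 'no
rough factor' main term (sharpMainTerm) and the 'one rough factor' terms (oneFlatFactor) are PROVED
(Theorems/DicksonFibrationDimOneStub{SieveCount,SingularTail,PrimeClassSums,PrimeSieve}.lean,
…DimOneReduction.lean) and twoFlatFactors_iff_dimOne shows DimOne ⟺ 'all terms with ≥ 2 rough
factors are o(N)' — i.e. ALL parity content of d = 1 sits in the |A| ≥ 2 terms, exactly this route's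
T_A with |A| ≥ 2; what this route adds is the sharp MÖBIUS truncation, under which those terms
become correlations of the pure Möbius object Λ♯ = (μ·1_{>P}) ⋆ log in progressions (the cores),
exposing Chowla/Matomäki–Radziwiłł/Tao/Pilatte technology and the 𝔽_q[T] theorem instead of
rough-number correlations. Imported areas: multiplicative number theory of μ (TaoFMP2016,
MatomakiRadziwillTao2015, HelfgottRadziwill2021, Pilatte2026) and the dispersion/large-sieve
philosophy (BombieriFriedlanderIwaniecActa1986) for the cores, GL₂/Kloosterman input
(DukeFriedlanderIwaniec1997Determinant) for the balanced window of TwinCores, and the 𝔽_q[T]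
dictionary (SawinShusterman2018) as evidence that the template closes, not as an input. Unlike
PrimeDeterminantCells (EH-strength seesaw law) and RoughSemiprimeRigidity (GEH + PairsToGHL) no
level beyond 1/2 is posited anywhere; the negatives index (ConvMomentLevelOne 9541, TupleElliott
14832, RectangleChowla 4218) is avoided by construction: no convolution moments, no multiplicative
slot, no free window exponent.

RANKED CRUXES. #2 PairCores (crux, stmt-Parity-15171) — TWO-POINT Λ♯-CORES HAVE LEVEL ν ON TAME
CLASSES: for every L, θ > 0, ν ≥ 0 with ν + θ < 1/2, A > 0, C ≥ 0 there is N₀ such that for N ≥ N₀,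
every non-degenerate pair system Ψ with ‖Ψ‖_N ≤ L, every choice of residues r_q and integer
intervals [u_q, v_q] ⊆ [−N, N]: Σ_{q ≤ N^ν, q tame} τ(q)^C |Σ_{u_q ≤ n ≤ v_q, n ≡ r_q (q)} Λ♯(ψ₁(n))
Λ♯(ψ₂(n))| ≤ N (log N)^{−A}, Λ♯(m) = Σ_{d | m, d > N^θ} μ(d) log(m/d) for m ≥ 1 and 0 for m ≤ 0
(inlined), q tame iff the whole shared part gcd(ψ_i(r_q), q) ≤ N^{θ/2} for i = 1, 2 (an `if`
indicator in the q-sum; rev 2 repair = the refuters' C″: rev 1's 'every class' was refuted-misstated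
— forced primes > N^θ make Λ♯ = −Λ♭ with a first-order main term, Σ_q|S_q| ≈ 19.5N at θ = 0.1, ν =
0.3; with g ≤ N^{θ/2} ≤ P, Σ_{d|g} μ(d) = 0 and P/d ≥ N^{θ/2}, so the class mean of Λ♯ vanishes to
all log powers; refuter rreview1 numerics N = 8·10⁶: tame |E| ≤ 0.034 vs non-tame 0.48). Zero main
term on every tame class; at ν = 0, Ψ = (n, n+h), θ = 1/2 − ε it is the card's CENTRE + CORE and,
given BV, EQUIVALENT to HL for Ψ — a Bombieri–Vinogradov theorem for prime PAIRS whose main-term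
bookkeeping has been emptied. Registered skeleton: Cruxes/PairCores/Lines/birth.lean. [difficulty:
open-problem] (why it might fail: HL-pair complete at ν = 0; shift-uniform log-power savings fail
under a Siegel zero (MatomakiMerikoski2023 Thm 1.3); needs Cesàro 2-point Chowla with (log N)^(4+A)
savings, only log-averaged o(1) known (TaoFMP2016, Pilatte2026); a subtler tame-class bias may
remain at ν > 0.) [SawinShusterman2018, TaoFMP2016, Pilatte2026, MatomakiRadziwillTao2015,
MatomakiMerikoski2023, Polymath8b2014, HelfgottRadziwill2021]
#3 HigherCores (crux, stmt-Parity-15172) — k-POINT Λ♯-CORES ON TAME CLASSES, k ≥ 3 (the cores met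
when all t factors of a t-tuple are opened; the species of Sawin–Shusterman's uniform dilated
k-point Chowla, Thm 4.5): same shape with Π_{i ≤ k} Λ♯(ψ_i(n)), N₀ depending on k, same tameness
indicator for every i ≤ k (rev 3 repair; rev 1 refuted-misstated by the CRT classes q_i | ψ_i(r_q),
q_i ∈ (N^0.1, N^0.13], Ψ = (n, n+2, n+6): Σ_q|S_q| ≥ 0.0086N). Registered skeleton:
Cruxes/HigherCores/Lines/birth.lean. [difficulty: open-problem] (why it might fail: k-point
Chowla-type cancellation along k dilated progressions with (log N)^(−A) savings and a level: for k ≥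
3 only log/loglog-averaged sign-pattern results exist (TaoTeravainenDuke2019); Siegel-sensitive like
the pairs; no k-point dispersion engine.) [SawinShusterman2018, TaoTeravainenDuke2019, Chowla1965,
TaoFMP2016, GreenTao2010]
#9 OpeningReduction (crux, ranked after the cores; restated 2026-08-17 with the d = 1 statement
inlined) — PairCores → HigherCores → [Dickson–Hardy–Littlewood at d = 1: ∀ t ≥ 1, L, ε > 0,
eventually in N, uniformly over non-degenerate Ψ : Fin t → AffLinForm 1 with ‖Ψ‖_N ≤ L and convex K
⊆ [−N, N], |vonMangoldtSum Ψ K N − archFactor·singularProduct| ≤ εN — verbatim the statement of the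
shared item DimOne, stmt-Parity-0819, no longer a separate item here]. The full-opening bookkeeping,
believed PROVABLE with known technology (XL in Lean), the route's own statement with no printed
counterpart, holed once (non-tame classes), hence a crux. Plan: t = 1 is PNT in progressions
(siegel_walfisz_holds); for t ≥ 2, θ = 1/(2t), P = N^θ, K⁺ = K ∩ {all ψ_i ≥ 1}, S = Σ_{A ⊆ [t]} T_A.
(i) T_∅: lattice count in ≤ L^t classes mod lcm(d⃗) ≤ N^{1/2} + the t-fold sharp-cutoff truncated
singular series TSS: Σ_{d⃗ ≤ P} Πμ(d_i) ρ(d⃗)/[d⃗] Π_{i∈I} log d_i = (−1)^t 𝔖(Ψ)·[I = [t]] +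
O_A((log P)^{−A}) uniformly in ‖Ψ‖_N ≤ L (GY-I Lemma 2.1 / GPY Prop. 1 technology; numerics agree to
3 digits). (ii) U_i := Σ_n Λ(ψ_i(n)) Π_{j≠i} Λ♭(ψ_j(n)) = T_∅ + T_{i}: ONE prime in ≤ L^t classes to
moduli a_i·lcm(d_j) ≤ L·N^{(t−1)θ} < N^{1/2}: Bombieri–Vinogradov (PROVED) with divisor weights
(Cauchy–Schwarz) and partial summation, main term by TSS; bookkeeping identity S = Σ_i U_i −
(t−1)T_∅ + Σ_{|A|≥2} T_A (PROVED in the skeleton: vonMangoldtSum_decomposition). (iii) |A| = k ≥ 2: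
discard the (d⃗, n) with shared part gcd(ψ_i(n), lcm_{j∉A} d_j) > N^{θ/2} (it divides Π_j gcd(a_i
b_j − a_j b_i, d_j), D_ij ≠ 0, |D_ij| ≤ 2L²N: mass ≪ N^{1−θ/(2t)+o(1)}), group by q = lcm ≤
N^{(t−k)θ} (multiplicity ≤ τ(q)^t, all surviving classes tame), partial summation into the choice
functions (u_q, v_q), worst tame class per q, apply PairCores/HigherCores to Ψ_A with (ν, θ, C) =
((t−k)θ, θ, t), ν + θ ≤ (t−1)θ < 1/2, A large. REGISTERED SKELETON (on the pre-restate id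
stmt-Parity-14639; decl name unchanged): Cruxes/OpeningReduction/Lines/birth.lean — stub_flatTerm
(i), stub_onePrimeTerms (ii), stub_coreTerms (iii), composition OpeningReduction_of kernel-checked;
after this repair it needs exactly one edit, `open … (OpeningReduction PairCores HigherCores)`
without `DimOne`, and re-registration (`ledger skeleton check … --crux <new id>`). TEMPLATES now in
the tree (sieve model, same cut): DicksonFibrationDimOneReduction.lean (interval bookkeeping,
corrTerm_empty/singleton), …StubPrimeClassSums.lean (BV class sums of Λ along a form),
…StubPrimeSieve.lean, …StubSieveCount.lean, twoFlatFactors_iff_dimOne. [difficulty: XL] (why it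
might fail: the t-fold sharp-cutoff TSS uniform in shifts |b| ≤ LN is not in print (GY-I Lemma 2.1
is per variable); a further unfiled main term could hide in (iii)'s discard/tameness step or the
weighted BV step — then the cores' FORM changes again.) [GoldstonYildirim2001,
GoldstonPintzYildirim2009, arXiv:math/0111212, arXiv:math/0506067, BombieriAsymptoticSieve1976,
IwaniecKowalski2004, GreenTao2010]
#1 Assembly (assembly, stmt-Parity-15173) — PairCores → HigherCores → GeneralizedHardyLittlewood:
the same obligation as OpeningReduction modulo the proved fibration lemma (one line either way; not
a binder of `closes`).
#9 TwinCores (support since 2026-08-17; was crux rank 4; stmt-Parity-14638) — THE TWIN INSTANCE: for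
0 < ε ≤ 1/4 and h ≥ 1, Σ_{n ≤ x} Λ♯_{x^{1/2−ε}}(n)·Λ♯_{x^{1/2−ε}}(n+h) = o(x), i.e. Σ_{BC − MN = h,
MN ≤ x, M, B > P} μ(M)μ(B) log N log C = o(x). A SPECIAL CASE of PairCores (CoresToTwin, provable
now) and EQUIVALENT to PairsHL(h) (TwinReduction + its provable converse): the banked, cheapest
complete test-bed of the line (numerics; DFI window; long/short lines), HL(h)-complete, deliberately
not staffed as a crux and not a hypothesis of `closes`. [SawinShusterman2018,
DukeFriedlanderIwaniec1997Determinant, HeathBrown1983PrimeTwins]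
#9 TwinReduction (support) — TwinCores → PairsHL (inlined: ∀ h ≥ 1, Σ_{n≤N} Λ(n)Λ(n+h) − 𝔖({0,h})N =
o(N)); the t = 2, ν = 0 bookkeeping at P = x^{1/2−ε}: Λ = μ ⋆ log split at d ≤ P, T_∅ + T_1 + T_2 =
𝔖x + o(x) by BV (PROVED) and TSS at t = 2 (𝔖+𝔖−𝔖, refuter-checked); odd h: 𝔖 = 0. [difficulty: L]
[BombieriAsymptoticSieve1976, GoldstonPintzYildirim2009, IwaniecKowalski2004]
#9 CoresToTwin (support) — PairCores → TwinCores (provable now, M): PairCores at L = 3, ν = 0, C =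
0, θ = 1/2 − ε, A = 1, Ψ = (⟨![1], 0⟩, ⟨![1], h⟩), q = 1, [u_1, v_1] = [1, N]; N/log N = o(N).
[difficulty: provable-now] [GreenTao2010, HardyLittlewood1923]

TWO-LAYER PLAN. Foreseen glued splits (k ≤ 3, depth 1; nothing filed now). OpeningReduction ⇐
FlatTerm (i) → OnePrimeTerms (ii) → CoreTerms (iii) → OpeningReduction — exactly the three
registered stubs of Cruxes/OpeningReduction/Lines/birth.lean with the glue OpeningReduction_of
already kernel-checked, to be filed as a split the moment a lead asks. PairCores ⇐
PairCoresLevelZero (ν = 0, all pair systems, shift-uniform) → PairCoresDispersion (the q-family: a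
two-point Barban–Davenport–Halberstam at power level) → PairCores. TwinCores (support) ⇐
CentreKloosterman (DFI 'Representations by the determinant' Thm 1, the balanced window; retired
stmt-Parity-5701) → LongLines (5696) → ShortLines (CoreVariance 5697 + glue 5703), i.e. the retired
route re-attached by signature, only if the test-bed is ever staffed. HigherCores: no split foreseen
before PairCores moves.

KILL CRITERIA. ¬TwinCores (some h, ε with the core provably not o(x)) is, by TwinReduction's
provable converse, ¬HL(h): it refutes Hardy–Littlewood pairs and with it every GHL route — close
`refuted:TwinCores` loudly. ¬PairCores or ¬HigherCores AT ν = 0 for some system is likewise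
¬(Hardy–Littlewood for that system) given OpeningReduction's bookkeeping: close `refuted:<Decl>`,
the sub-problem is decided negatively. ¬PairCores / ¬HigherCores only at some level ν₀ > 0 (a biased
family of progressions) does NOT kill the line: OpeningReduction needs only ν = (t−k)θ with θ as
small as we like, so the crux is re-filed with the side condition ν < ν₀ (repair, new decl) and the
reduction re-certified. A bookkeeping gap in OpeningReduction / TwinReduction / CoresToTwin is a
misstatement of the cores' FORM: restate the cores with the stronger form, never close — DONE ONCE
(rev 2–3, 2026-08-16: non-tame classes; tameness indicator added, OpeningReduction amended with the
discard step and re-kinded crux). A refutation of the TAME cores at some ν₀ > 0 by a residual class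
bias is again a FORM defect (tighten tameness, e.g. g ≤ N^{θ/4} or g | P-smooth part, and re-derive
(iii)); at ν = 0 it is ¬HL. 2026-08-17 re-badge (skeleton.hides-summit on the shared target
stmt-Parity-0819): DimOne and FibrationLemma DROPPED as items — a statement proved equivalent to the
summit (generalizedHardyLittlewood_iff_dimOne, summit_iff_dimOne, twoFlatFactors_iff_dimOne) is not
carried as an item of this route; the d = 1 waypoint lives inside OpeningReduction's conclusion and
the proved fibration lemma inside `closes`. Moot if GHL (equivalently DimOne, equivalently
TwoFlatFactors) is proved or refuted by any route; superseded if another full-opening route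
(LiouvilleOpening, ClassVarianceLadder, PolynomialKatai, EntropyRate — census D-g of
Cruxes/DimOne/STRATEGY-CENSUS.md) closes its cores first.

NOT DECOMPOSED YET. The truncated-singular-series lemma (t-fold, sharp cutoffs, uniform in shifts ≤
LN and in the ≤ t²·log N 'bad' primes), the divisor-weighted BV step, the Shiu-free trivial bounds
and the partial summations — all inside OpeningReduction (helper lemmas ride with --supports, or the
three-way split above); the converse PairsHL → TwinCores (true, provable, not needed by `closes`);
the centre/long/short split of TwinCores and the Literature cite-fact for DFI Thm 1 it needs; a
Möbius-model ↔ sieve-model comparison (T_A vs the tree's corrTerm T: the two expansions agree only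
after summing |A| ≤ 1, so the landed sharpMainTerm/oneFlatFactor do NOT shortcut (i)–(ii), they are
templates); log-averaged and almost-all-scales rungs of the cores
(Literature.Barriers.Parity.LogarithmicAveraging: they do not transfer, not filed); a separate
no-Siegel-zero item (the Siegel sensitivity is INSIDE PairCores/HigherCores as typed; card
siegel-hardness-uniform-ghl owns that axis); t-point numerics; the notion `moebiusLargeDivisorPart`
(Definition requests).

CHEAPEST FALSIFIER. (0) Minutes with the refuter's cores_bias.py (E1/E2 modes, attached to
stmt-Parity-14637): the class mean (q/N)Σ_{n ≡ r (q)} Λ♯_P(ψ_i(n)) on TAME classes — shared part g =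
6, 30, p′p″ with p′p″ ≤ N^{θ/2} — must be ≈ 0 at N = 3·10⁷ (against −1·(rel.) on a forced prime > P
and (1−θ)log N-size on p ∈ (P/2, P]); a tame class with an O(1) relative mean kills the repaired
FORM (tighten tameness) — not the line. (1) Logical, an hour for a refuter (run once by
refuter-rattack/g45-12 at rev 1 — it found the non-tame hole, now repaired): redo the t = 3
bookkeeping of OpeningReduction on Ψ = (n, n+2, n+6), θ = 1/6 — expand Π(Λ♭ + Λ♯), confirm that the
|A| ≤ 1 terms need only ONE prime in progressions of modulus ≤ N^(1/3), that TSS gives 3𝔖 − 2𝔖 = 𝔖,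
and that after the discard step every class handed to the cores is tame; a surviving term needing
prime PAIRS in progressions, or a main term inside some T_A with |A| ≥ 2 on a tame class, kills the
'provable' label of OpeningReduction. (2) Numerics (kit, minutes at x = 10⁷–10⁹; local run at x =
2·10⁵ in numerics/cores_check.py of the opening planner): at P = x^0.45, h = 2, 6: CORE/x = −0.054,
−0.122 (ℓ¹ masses 4.7x, 4.9x), MAIN/x = 1.376, 2.739 vs 𝔖 = 1.320, 2.641; CORE/x must keep shrinking
and MAIN/x → 𝔖(h); CORE/x stabilising away from 0 while S/x → 𝔖 kills TwinReduction's normalisation,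
not HL. (3) TSS sanity done (tss_check.py, R ≤ 10⁶, h = 2, 6, 30, 3): no-log / one-log truncated
sums 1.5e-7 / 2.3e-4, two-log sum 1.3139 / 2.6383 / 3.5180 / −0.003 vs 𝔖 = 1.3203 / 2.6407 / 3.5209
/ 0.

NUMBERS. θ_t = 1/(2t) (any θ < 1/(2(t−1)) works): BV moduli ≤ L·N^((t−1)/(2t)) < N^(1/2); core
levels ν = (t−k)/(2t) ≤ (t−2)/(2t), ν + θ ≤ (t−1)/(2t) < 1/2; divisor weight exponent C = t; T_∅
moduli ≤ N^(1/2). Pairs: any θ < 1/2 (card: θ = 1/2 − ε, DFI window x^(1/2−ε) < M, B ≤ x^(1/2+2ε),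
window error x^(95/96+O(ε)), ε ≤ 1/191 via DukeFriedlanderIwaniec1997 Thm 2, 1/39 via
BettinChandee2018 — addendum cards). ℓ¹ mass of TwinCores ≍ x·log⁴x/384 per half (measured 4.7x at x
= 2·10⁵, θ = 0.45). Known partial results the cores are measured against: log-averaged 2-point
Chowla/Elliott (TaoFMP2016; HelfgottRadziwill2021, Pilatte2026), shift-averaged Chowla H = X^ε
(MatomakiRadziwillTao2015), averaged HL over h ≤ X^(8/33) (MatomakiRadziwillTao2019), k-point Chowla
with power saving over 𝔽_q[T] uniformly in dilations (SawinShusterman2018 Thm 1.1/4.5, q >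
685090p²). Items since the 2026-08-17 re-badge: 7 (3 cruxes PairCores/HigherCores/OpeningReduction =
exactly the binders of `closes`, 3 support TwinCores/TwinReduction/CoresToTwin, 1 assembly);
dropped: DimOne (0819, shared target ⟺ summit), FibrationLemma (0822, proved, now used as a
theorem); imports: Literature.NumberTheory.Sieve.SingularSeries and
Summits.Parity.GeneralizedHardyLittlewood.Theorems.LeeYangFibresFibrationLemmaFinal (the Theses-free
proved fibration lemma for `closes`); named unproved Literature facts used as hypotheses: 0 (cone:
BV and Siegel–Walfisz are used inside proofs, never in statements; the module-import cone's
GeneralizedHardyLittlewood/Count, GreenTaoZiegler2012, HardyLittlewoodConjE, BatemanHorn,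
bfi_wellFactorable_level ride in on the operator Statement modules and are hypotheses of nothing).

DEFINITION REQUESTS. None blocking — Λ♯ is inlined as a divisor sum in every signature. Later
clean-up: notion `moebiusLargeDivisorPart (P : ℝ) (m : ℕ) : ℝ := Σ_(d | m, P < d) μ(d) log(m/d)`
(topic Summits/Parity/GeneralizedHardyLittlewood/Theorems) to shorten
PairCores/HigherCores/TwinCores. Cite-facts wanted (filed by whoever takes the children):
Duke–Friedlander–Iwaniec 1997 'Representations by the determinant' Thm 1 (for the CentreKloosterman
child of TwinCores); Shiu 1980 Brun–Titchmarsh for multiplicative functions (convenience for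
OpeningReduction, avoidable by Cauchy–Schwarz); Goldston–Yıldırım arXiv:math/0111212 Lemma 2-type
truncated divisor-sum asymptotics (convenience for TSS; GoldstonYildirimLemma21 vendored by grounder
g23-6).

Novelty: Searches (2026-08-15): `lit search --source crossref "higher correlations of divisor sums related to
primes Goldston Yildirim"` (10; GY II/III doi:10.1112/plms/pdm010, doi:10.1112/plms/pdm021, GGPY
doi:10.1093/imrn/rnq124); `lit search --source zbmath "Chowla conjecture twin primes"` (5:
doi:10.4007/annals.2022.196.2.1 = SawinShusterman2018, doi:10.1093/imrn/rnad069 =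
MatomakiMerikoski2023, doi:10.1007/s00209-018-2177-z Vatwani 2019, doi:10.1007/s11537-019-1837-z
Maynard survey); `lit read arXiv:1808.04001` pp.2, 30–31 (Thm 6.3 opens ONE Λ and needs prime level
1/(2−ω) > 1/2; pairs only, Remark 1.2); `lit frontier Parity --since 2021` (30 rows: nearest
doi:10.1090/proc/17544 'On variants of Chowla', doi:10.1007/s00222-026-01408-6 'Higher uniformity
II', Tao–Teräväinen Siegel-zero HLC arXiv:2109.06291 — none opens both/all factors); `lit galaxy
search --star all` ×2 ("Chowla conjecture in arithmetic progressions": 0 rows; "correlations of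
divisor sums related to primes": pdf GGPY arXiv:math/0506067, arXiv:2109.06291, 3 irrelevant books);
`lit search --hybrid` (vector leg only, index busy: no relevant held book); arXiv and Semantic
Scholar HTTP 429 (recorded, not consulted); all 23 Theses files of the sub and the sibling cards
dimension-dial-determinant, msp-as-chowla-in-progressions, signed-mobius-level-sqrt,
mu-column-two-thirds-wall read for overlap (none lifts the double opening to all t).
Nearest prior art found: SawinShusterman2018 (arXiv:1808.04001 §6, Thm 6.3/Cor 6.1/Th  [refs: 10.1112/plms/pdm010, 10.1112/plms/pdm021, 10.1093/imrn/rnq124, 10.4007/annals.2022.196.2.1, 10.1093/imrn/rnad069, 10.1007/s00209-018-2177-z, 10.1007/s11537-019-1837-z, 10.1090/proc/17544, 10.1007/s00222-026-01408-6, 1808.04001, 2109.06291, math/0506067, math/0111212, doi:10.1112/plms/pdm010, doi:10.1112/plms/pdm021, doi:10.1093/imrn/rnq124, doi:10.4007/annals.2022.196.2.1, doi:10.1093/imrn/rnad069]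

Barriers (technique_class: determinant-equation dilated-chowla bombieri-vinogradov): - technique_class: determinant-equation dilated-chowla bombieri-vinogradov
- Literature.Barriers.Parity.SelbergParityBarrier: Type-I data (BV, level < 1/2) enter only the
terms T_A with |A| ≤ 1, which provably carry 𝔖β_∞ and nothing parity-sensitive; the decisive inputs
are SIGNED Möbius core statements that Selberg's (1 ± λ)-twisted ghosts violate — the barrier is
paid for, not evaded, exactly as
Literature.NumberTheory.Sieve.bombieri_asymptotic_sieve_indeterminacy prescribes.
- Literature.Barriers.Parity.FordFixedLevelBarrier: no asymptotic is deduced from a fixed level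
alone; level-(1/2 − δ) information feeds only the |A| ≤ 1 terms, and Ford's extremal examples live
in the cores, which are attacked by signed statements.
- Literature.Barriers.Parity.LargeSieveLevelHalf: every prime-distribution input stays strictly
below 1/2 ((t−1)θ < 1/2, ν + θ < 1/2); beyond that the route asks for Möbius cancellation (and, in
the TwinCores child, Kloosterman-fraction cancellation), never for primes in progressions.
- Literature.Barriers.Parity.PrimePairParity: Polymath's weight insertion ω = 1 − λ(n)λ(n+h) is not
a function of the opened variables (d_i, e_i), so the deduction is outside the barrier's class; the
extra axioms are of the 'bilinear/Möbius' kind §8 isolates as the only exit, PairCores at ν > 0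
being a dilated, power-level relative of Polymath2014_liouvillePairAP.
- Literature.Barriers.Parity.FordMaynardMinimalTypeII: respected — the cores are Type-II-strength
(both Möbius var

History (route lifecycle, newest last):
- 2026-08-16T10:29:05Z · rev 2: restated PairCores (stmt-Parity-14636) — repair (route-repair seat rground-c7b94429): PairCores refuted-misstated AS FILED by refuter-rattack-stmt-Parity-14636/14637 (non-tame CRT classes: first-order (planner-rground-Parity-DeterminantMoebiusCores-c7b94429-0)
- 2026-08-16T10:31:20Z · rev 3: restated HigherCores (stmt-Parity-14637) — repair (route-repair seat rground-c7b94429): HigherCores refuted-misstated AS FILED by refuter-rattack-stmt-Parity-14637 (CRT classes q_i | ψ_i(r_q), q_i primes (planner-rground-Parity-DeterminantMoebiusCores-c7b94429-0)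
- 2026-08-16T10:33:17Z · rev 5: restated Assembly (stmt-Parity-14642) — repair (route-repair seat rground-c7b94429, ground-failed): RESTATE the `Assembly` item (stmt-Parity-14642) — the route's only blocking ground flag (ground.triv (planner-rground-Parity-DeterminantMoebiusCores-c7b94429-0)
- 2026-08-17T11:56:10Z · skeleton.hides-summit: stub_twoFlatFactors (stmt-Parity-0819) ⟷ summit (accepted theorem in Summits/Parity/GeneralizedHardyLittlewood/Theorems/DicksonFibrationDimOneEquivalence.lean) (prover-line-stmt-Parity-0819-c2-0)
- 2026-08-17T12:25:07Z · rev 6: restated OpeningReduction (stmt-Parity-14639) — re-badge repair 1/3 (skeleton.hides-summit on shared target stmt-Parity-0819): restate OpeningReduction with the d = 1 statement (= DimOne's signature) INLINED, (planner-rbadge-Parity-DeterminantMoebiusCores-c7b94429-0)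
- 2026-08-17T12:27:26Z · rev 7: dropped DimOne, FibrationLemma — re-badge repair 2/3: drop DimOne + FibrationLemma as items (summit-equivalent target / proved lemma now used as a theorem), closes := FibrationGlue.generalizedH (planner-rbadge-Parity-DeterminantMoebiusCores-c7b94429-0)
- 2026-08-24T05:53:55Z · DORMANT — reconciler: no traction for 6.6 d (last activity item-evidence-added at 2026-08-17T15:38:54Z); parked, not closed — `ledger route dormant route-Parity-Determina (operator:999:3495871)

sub-problem: GeneralizedHardyLittlewood · status: dormant · opened planner-plancard-Parity-GeneralizedHardyLittl-9f803cd8-g2-0 2026-08-15T19:10:26Z · rev 8 · ledger route-Parity-DeterminantMoebiusCores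
GENERATED by the gate from the ledger (D-0016/17). Provers cite these decls: `theorem foo : Summit.Parity.GeneralizedHardyLittlewood.Theses.DeterminantMoebiusCores.<Decl> := …` in Summits/Parity/GeneralizedHardyLittlewood/Theorems/<Name>.lean.
-/

namespace Summit.Parity.GeneralizedHardyLittlewood.Theses.DeterminantMoebiusCores

open scoped BigOperators Topology Manifold Classical MeasureTheory ProbabilityTheory Matrix InnerProductSpace ComplexConjugate ContinuousMap
open Filter Set Function TopologicalSpace MeasureTheory

attribute [summit_statement] _root_.GeneralizedHardyLittlewood

-- earlier PairCores (stmt-Parity-14636, replaced 2026-08-16T10:29:05Z -> stmt-Parity-15171): retired by None — ∀ (L : ℕ) (θ ν A C : ℝ), 0 < θ → 0 ≤ ν → ν + θ < 1 / 2 → 0 < A → 0 ≤ C → ∃ N₀ : ℕ, ∀ N : ℕ, N₀ ≤ N → ∀ Ψ : Fin 2 → Literature.NumberTheory.Sieve.AffLinForm 1, Literature.NumberTheory.Sieve.IsNondegenerateSystem Ψ → Literature.NumberTheory.Sieve.affLinSize Ψ N ≤ L → ∀ (r u v : ℕ → ℤ), (∀ q :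
/-- item stmt-Parity-15171 · crux · rank 2 · open · by planner
why it might fail: HL-pair complete at ν=0; shift-uniform log-power savings fail under a Siegel zero (MatomakiMerikoski2023 Thm 1.3); needs Cesàro 2-point Chowla with (log N)^(4+A) savings, only log-averaged o(1) known (TaoFMP2016, Pilatte2026); a subtler tame-class bias may remain at ν>0.
sources: SawinShusterman2018, TaoFMP2016, Pilatte2026, MatomakiRadziwillTao2015, MatomakiMerikoski2023, Polymath8b2014
[crux] TWO-POINT Λ♯-CORES HAVE LEVEL ν ON TAME CLASSES (repaired 2026-08-16 after the crux attacks
refuter-rattack-stmt-Parity-14636/14637, class refuted-misstated; this is the refuters' repair C″ in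
whole-gcd form): for every L, θ > 0, ν ≥ 0 with ν + θ < 1/2, A > 0, C ≥ 0 there is N₀ such that for
N ≥ N₀, every non-degenerate pair system Ψ = (a₁n+b₁, a₂n+b₂) with ‖Ψ‖_N ≤ L (so |b_i| ≤ LN), every
choice of residues r_q and of integer intervals [u_q, v_q] ⊆ [−N, N]: Σ_{q ≤ N^ν, q TAME} τ(q)^C
|Σ_{u_q ≤ n ≤ v_q, n ≡ r_q (q)} Λ♯(ψ₁(n)) Λ♯(ψ₂(n))| ≤ N (log N)^{−A}, where Λ♯(m) = Σ_{d | m, d >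
N^θ} μ(d) log(m/d) for m ≥ 1 and 0 for m ≤ 0 (inlined as a divisor sum), and q is TAME for (Ψ, r_q)
iff the WHOLE shared part gcd(ψ_i(r_q), q) is ≤ N^{θ/2} for both i (rendered as an `if … then |…|
else 0` indicator inside the q-sum: nothing is asserted, and nothing demanded, on non-tame classes).
Why the restriction is the right one: on a class that forces into ψ_i(n) either a prime p > N^θ or a
block g of primes with g > N^θ (or with N^θ/g bounded), Λ(ψ_i(n)) = 0 while Λ♭_{N^θ} keeps a
FIRST-ORDER main term (exact identity Λ♯_P(p·m) = −Σ_{d|m, d≤P} μ(d) log(pm/d) for prime p > P,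
Lean-checked by -/
@[route_item "route-Parity-DeterminantMoebiusCores", crux]
def PairCores : Prop :=
  ∀ (L : ℕ) (θ ν A C : ℝ), 0 < θ → 0 ≤ ν → ν + θ < 1 / 2 → 0 < A → 0 ≤ C → ∃ N₀ : ℕ, ∀ N : ℕ, N₀ ≤ N → ∀ Ψ : Fin 2 → Literature.NumberTheory.Sieve.AffLinForm 1, Literature.NumberTheory.Sieve.IsNondegenerateSystem Ψ → Literature.NumberTheory.Sieve.affLinSize Ψ N ≤ L → ∀ (r u v : ℕ → ℤ), (∀ q : ℕ, -(N : ℤ) ≤ u q ∧ v q ≤ N) → ∑ q ∈ Finset.Icc 1 ⌊(N : ℝ) ^ ν⌋₊, ((Nat.divisors q).card : ℝ) ^ C * (if ∀ i : Fin 2, ((Int.gcd ((Ψ i).eval (fun _ => r q)) q : ℕ) : ℝ) ≤ (N : ℝ) ^ (θ / 2) then |∑ n ∈ (Finset.Icc (u q) (v q)).filter (fun n : ℤ => (q : ℤ) ∣ n - r q), ∏ i : Fin 2, (∑ d ∈ Nat.divisors ((Ψ i).eval (fun _ => n)).toNat, if (N : ℝ) ^ θ < (d : ℝ) then (ArithmeticFunction.moebius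 d : ℝ) * Real.log (((((Ψ i).eval (fun _ => n)).toNat : ℕ) : ℝ) / (d : ℝ)) else 0)| else 0) ≤ (N : ℝ) / Real.log N ^ A

-- earlier HigherCores (stmt-Parity-14637, replaced 2026-08-16T10:31:20Z -> stmt-Parity-15172): retired by None — ∀ (k L : ℕ) (θ ν A C : ℝ), 3 ≤ k → 0 < θ → 0 ≤ ν → ν + θ < 1 / 2 → 0 < A → 0 ≤ C → ∃ N₀ : ℕ, ∀ N : ℕ, N₀ ≤ N → ∀ Ψ : Fin k → Literature.NumberTheory.Sieve.AffLinForm 1, Literature.NumberTheory.Sieve.IsNondegenerateSystem Ψ → Literature.NumberTheory.Sieve.affLinSize Ψ N ≤ L → ∀ (r u v : ℕ 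
/-- item stmt-Parity-15172 · crux · rank 3 · open · by planner
why it might fail: k-point Chowla-type cancellation along k dilated progressions with (log N)^(−A) savings and a level: for k ≥ 3 only log/loglog-averaged sign-pattern results exist (TaoTeravainenDuke2019); Siegel-sensitive like the pairs; no k-point dispersion engine; a residual tame-class bias may remain at ν>0.
sources: SawinShusterman2018, TaoTeravainenDuke2019, Chowla1965, TaoFMP2016, GreenTao2010, GoldstonYildirim2001
[crux] k-POINT Λ♯-CORES ON TAME CLASSES, k ≥ 3 (repaired 2026-08-16 after
refuter-rattack-stmt-Parity-14637, class refuted-misstated; refuters' repair C″ in whole-gcd form —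
card S3, the cores met when all t factors of a t-tuple are opened; the species of Sawin–Shusterman's
uniform dilated k-point Chowla, Thm 4.5): for every k ≥ 3, L, θ > 0, ν ≥ 0 with ν + θ < 1/2, A > 0,
C ≥ 0 and N ≥ N₀, uniformly over non-degenerate systems of k forms of size ≤ L, all residues r_q and
integer intervals [u_q, v_q] ⊆ [−N, N]: Σ_{q ≤ N^ν, q TAME} τ(q)^C |Σ_{u_q ≤ n ≤ v_q, n ≡ r_q (q)}
Π_{i ≤ k} Λ♯(ψ_i(n))| ≤ N (log N)^{−A} — k-point Möbius correlations on the lines of {d_i e_i =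
ψ_i(n)} in progressions, with the same inlined Λ♯ = Σ_{d|m, d>N^θ} μ(d) log(m/d) and the same
tameness indicator (whole shared part gcd(ψ_i(r_q), q) ≤ N^{θ/2} for every i ≤ k; `if … then |…|
else 0` inside the q-sum). As filed ('every class') it was false once ν > kθ: CRT classes q_i |
ψ_i(r_q), q = q₁q₂q₃, q_i primes in (N^0.1, N^0.13], Ψ = (n, n+2, n+6), θ = 0.1, ν = 0.39 give S_q =
−(N/q)(𝔖 + o(1)) and Σ_q|S_q| ≥ 0.0086·N (refuter-rattack-stmt-Parity-14637, numerics N = 3·10⁷: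
pooled −32.12 vs predicted −32.07); the tame -/
@[route_item "route-Parity-DeterminantMoebiusCores", crux]
def HigherCores : Prop :=
  ∀ (k L : ℕ) (θ ν A C : ℝ), 3 ≤ k → 0 < θ → 0 ≤ ν → ν + θ < 1 / 2 → 0 < A → 0 ≤ C → ∃ N₀ : ℕ, ∀ N : ℕ, N₀ ≤ N → ∀ Ψ : Fin k → Literature.NumberTheory.Sieve.AffLinForm 1, Literature.NumberTheory.Sieve.IsNondegenerateSystem Ψ → Literature.NumberTheory.Sieve.affLinSize Ψ N ≤ L → ∀ (r u v : ℕ → ℤ), (∀ q : ℕ, -(N : ℤ) ≤ u q ∧ v q ≤ N) → ∑ q ∈ Finset.Icc 1 ⌊(N : ℝ) ^ ν⌋₊, ((Nat.divisors q).card : ℝ) ^ C * (if ∀ i : Fin k, ((Int.gcd ((Ψ i).eval (fun _ => r q)) q : ℕ) : ℝ) ≤ (N : ℝ) ^ (θ / 2) then |∑ n ∈ (Finset.Icc (u q) (v q)).filter (fun n : ℤ => (q : ℤ) ∣ n - r q), ∏ i : Fin k, (∑ d ∈ Nat.divisors ((Ψ i).eval (fun _ => n)).toNat, if (N : ℝ)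 ^ θ < (d : ℝ) then (ArithmeticFunction.moebius d : ℝ) * Real.log (((((Ψ i).eval (fun _ => n)).toNat : ℕ) : ℝ) / (d : ℝ)) else 0)| else 0) ≤ (N : ℝ) / Real.log N ^ A

-- earlier OpeningReduction (stmt-Parity-14639, replaced 2026-08-17T12:25:07Z -> stmt-Parity-18172): retired by None — PairCores → HigherCores → DimOne
/-- item stmt-Parity-18172 · crux · rank 9 · open · by planner
why it might fail: Route's own XL bookkeeping, no printed counterpart, holed once (non-tame classes): the t-fold sharp-cutoff TSS uniform in shifts |b| ≤ LN is not in print (GY-I Lemma 2.1 is per variable); (iii)'s discard/tameness step or the weighted BV step may hide another main term.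
sources: GoldstonYildirim2001, GoldstonPintzYildirim2009, arXiv:math/0111212, arXiv:math/0506067, BombieriAsymptoticSieve1976, IwaniecKowalski2004
[crux] THE FULL-OPENING BOOKKEEPING, restated 2026-08-17 (re-badge repair, skeleton.hides-summit on
the shared target stmt-Parity-0819) with the d = 1 statement INLINED: PairCores → HigherCores →
[Dickson–Hardy–Littlewood at d = 1 — ∀ t ≥ 1, L, ε > 0, ∃ N₀, ∀ N ≥ N₀, uniformly over
non-degenerate Ψ : Fin t → AffLinForm 1 with affLinSize Ψ N ≤ L (shifts |b_i| ≤ LN) and convex K ⊆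
realBox 1 N: |vonMangoldtSum Ψ K N − archFactor Ψ K · singularProduct Ψ| ≤ εN — verbatim the
signature of DimOne (stmt-Parity-0819), which is no longer an ITEM of this route because it is
proved equivalent to the summit (EngineToGHL.generalizedHardyLittlewood_iff_dimOne) and its only
skeleton hides the summit (stub_twoFlatFactors)]. Same mathematics as before the restate
(definitionally: the old conclusion `DimOne` unfolded); `closes` now post-composes with the PROVED
Theses-free fibration lemma Theorems.FibrationGlue.generalizedHardyLittlewood_of_dimOne. Believed
PROVABLE with known technology (XL in Lean); the route's own statement with no printed counterpart,
holed once (rev 1, non-tame classes), hence a crux ranked after the cores. Plan: t = 1 is PNT in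
progressions (siegel_walfisz_holds). For t ≥ 2: θ -/
@[route_item "route-Parity-DeterminantMoebiusCores", crux]
def OpeningReduction : Prop :=
  PairCores → HigherCores → ∀ (t L : ℕ), 1 ≤ t → ∀ ε : ℝ, 0 < ε → ∃ N₀ : ℕ, ∀ N : ℕ, N₀ ≤ N → ∀ Ψ : Fin t → Literature.NumberTheory.Sieve.AffLinForm 1, Literature.NumberTheory.Sieve.IsNondegenerateSystem Ψ → Literature.NumberTheory.Sieve.affLinSize Ψ N ≤ L → ∀ K : Set (Fin 1 → ℝ), Convex ℝ K → K ⊆ Literature.NumberTheory.Sieve.realBox 1 N → |Literature.NumberTheory.Sieve.vonMangoldtSum Ψ K N - Literature.NumberTheory.Sieve.archFactor Ψ K * Literature.NumberTheory.Sieve.singularProduct Ψ| ≤ ε * (N : ℝ)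

/-- item stmt-Parity-14638 · support · rank 4 · open · by planner
why it might fail: Equivalent to HL(h): twin-prime complete; ℓ¹ mass ≍ x·log⁴x forces (log x)^(4+δ) savings on Cesàro pair-Chowla sums; no signed cross-line engine; DFI reaches only the balanced window.
sources: SawinShusterman2018, DukeFriedlanderIwaniec1997Determinant, HeathBrown1983PrimeTwins, TaoFMP2016
[crux] THE TWIN INSTANCE (card Crux 1 + Crux 2; = CENTRE + CORE of the retired route
DeterminantMoebius with P = x^{1/2−ε}): for 0 < ε ≤ 1/4 and h ≥ 1, Σ_{n ≤ x} Λ♯_{x^{1/2−ε}}(n) ·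
Λ♯_{x^{1/2−ε}}(n+h) = o(x), i.e. Σ_{BC − MN = h, MN ≤ x, M > P, B > P} μ(M) μ(B) log N log C = o(x):
Möbius is random on the lines of the determinant variety once both Möbius variables exceed
x^{1/2−ε}. By TwinReduction and its (equally provable) converse this is EQUIVALENT to PairsHL(h) for
each ε, so it is the cheapest complete test-bed of the line (numerics; DFI Kloosterman fractions on
the balanced window x^{1/2−ε} < M, B ≤ x^{1/2+2ε}; Chowla technology on the ≲ √x long lines; a
BDH-type variance bound on the short lines); implied by PairCores (CoresToTwin). [deps: PairCores]
[difficulty: open-problem] -/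
@[route_item "route-Parity-DeterminantMoebiusCores"]
def TwinCores : Prop :=
  ∀ ε : ℝ, 0 < ε → ε ≤ 1 / 4 → ∀ h : ℕ, 1 ≤ h → (fun x : ℕ => ∑ n ∈ Finset.Icc 1 x, (∑ d ∈ Nat.divisors n, if (x : ℝ) ^ (1 / 2 - ε) < (d : ℝ) then (ArithmeticFunction.moebius d : ℝ) * Real.log ((n : ℝ) / (d : ℝ)) else 0) * (∑ d ∈ Nat.divisors (n + h), if (x : ℝ) ^ (1 / 2 - ε) < (d : ℝ) then (ArithmeticFunction.moebius d : ℝ) * Real.log (((n + h : ℕ) : ℝ) / (d : ℝ)) else 0)) =o[Filter.atTop] fun x : ℕ => (x : ℝ)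

/-- item stmt-Parity-14640 · support · rank 9 · open · by planner
sources: BombieriAsymptoticSieve1976, GoldstonPintzYildirim2009, CojocaruMurty2005, IwaniecKowalski2004, SawinShusterman2018
[support] TwinCores → PairsHL, with PairsHL (= TauberianTwins/RoughSemiprimeRigidity.PairsHL,
stmt-Parity-0867/9387: ∀ h ≥ 1, Σ_{n≤N} Λ(n)Λ(n+h) − 𝔖({0,h})N = o(N)) INLINED so that the item does
not depend on rendering order (provable, L): the t = 2, ν = 0 case of the bookkeeping at P =
x^{1/2−ε} (any one ε ≤ 1/4 suffices): Σ_{n≤x} Λ(n)Λ(n+h) = T_∅ + T_1 + T_2 + CORE exactly (Mathlib: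
vonMangoldt = μ ⋆ log, i.e. ArithmeticFunction.vonMangoldt_eq_moebius_mul_log-type identity, split
at d ≤ P), and T_∅ + T_1 + T_2 = 𝔖({0,h})x + o(x): T_1 + T_∅ = Σ_{d ≤ P} μ(d) Σ_{d | n ≤ x} log(n/d)
Λ(n+h) and its mirror image are primes in progressions mod d ≤ x^{1/2−ε} (Bombieri–Vinogradov,
PROVED) with main terms → 𝔖x each by the PNT rates Σ_{(d,h)=1} μ(d)/φ(d) = 0, −Σ μ(d) log
d/φ(d)·(correction) = 𝔖(h); T_∅ = x·[log²-weighted Σ_{d,b ≤ P, (d,b)|h} μ(d)μ(b)/[d,b](…)] +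
O(P²log²x) → 𝔖x (TSS at t = 2: the no-log and one-log sums vanish in the limit, the two-log sum →
𝔖(h); = MainRegimes 𝔖+𝔖−𝔖 of the retired route, refuter-checked). Odd h: all three limits are 𝔖 = 0.
[difficulty: L] -/
@[route_item "route-Parity-DeterminantMoebiusCores"]
def TwinReduction : Prop :=
  TwinCores → ∀ h : ℕ, 1 ≤ h → (fun N : ℕ => ∑ n ∈ Finset.Icc 1 N, ArithmeticFunction.vonMangoldt n * ArithmeticFunction.vonMangoldt (n + h) - Literature.NumberTheory.Sieve.singularSeries ({0, (h : ℤ)} : Finset ℤ) * N) =o[Filter.atTop] fun N : ℕ => (N : ℝ)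

/-- item stmt-Parity-14641 · support · rank 9 · open · by planner
sources: GreenTao2010, HardyLittlewood1923
[support] PairCores → TwinCores (provable now, bookkeeping, M): apply PairCores with L = 3, ν = 0, C
= 0, θ = 1/2 − ε, A = 1 to Ψ = (n, n + h) = (⟨![1], 0⟩, ⟨![1], h⟩) (non-degenerate; ‖Ψ‖_N = 2 + h/N
≤ 3 for N ≥ h), q = 1, [u_1, v_1] = [1, N]; the inner sum is TwinCores' sum at x = N after
identifying ((Ψ i).eval (fun _ => n)).toNat with n and n + h; N/(log N) = o(N). [difficulty:
provable-now] -/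
@[route_item "route-Parity-DeterminantMoebiusCores"]
def CoresToTwin : Prop :=
  PairCores → TwinCores

-- earlier Assembly (stmt-Parity-14642, replaced 2026-08-16T10:33:17Z -> stmt-Parity-15173): retired by None — PairCores → HigherCores → OpeningReduction → FibrationLemma → GeneralizedHardyLittlewood
/-- item stmt-Parity-15173 · assembly · rank 1 · open · by planner
sources: GreenTao2010, SawinShusterman2018, BombieriAsymptoticSieve1976
[assembly] The two staffing cruxes imply the sub-problem: PairCores → HigherCores →
GeneralizedHardyLittlewood (restated at rev 5 from the rev-1 tautology PairCores → HigherCores →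
OpeningReduction → FibrationLemma → GHL, which the ground battery closes by `intros; aesop`).
Content = OpeningReduction (the full-opening bookkeeping, tame cores ⇒ DimOne) composed with the
PROVED fibration lemma (FibrationLemma_holds = leeYangFibres_fibrationLemma): `theorem
Assembly_holds : Assembly := fun hP hH => FibrationLemma_holds (openingReduction_holds hP hH)`.
Provers: prove OpeningReduction (crux, XL) and close this in one line; the route's DECIDING theorem
is `closes`, not this item. -/
@[route_item "route-Parity-DeterminantMoebiusCores"]
def Assembly : Prop :=
  PairCores → HigherCores → GeneralizedHardyLittlewood

-- records of items no longer active in this route (dropped / restated):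
-- earlier FibrationLemma (stmt-Parity-0822, dropped 2026-08-17T12:27:26Z): proved by Summit.Parity.GeneralizedHardyLittlewood.Theorems.leeYangFibres_fibrationLemma — DimOne → GeneralizedHardyLittlewood

/-! D-0027 §2.1 — DECIDING THEOREM (planner-authored via `route open/edit --closes-file`; by planner-rbadge-Parity-DeterminantMoebiusCores-c7b94429-0 2026-08-17T12:27:26Z):
its hypotheses are this route's items and its conclusion the sub-problem Statement (glue_lint), and it elaborates with this file. -/

@[closes "route-Parity-DeterminantMoebiusCores"] theorem closes (hP : PairCores) (hH : HigherCores) (hR : OpeningReduction) :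
    _root_.GeneralizedHardyLittlewood :=
  _root_.Summit.Parity.GeneralizedHardyLittlewood.Theorems.FibrationGlue.generalizedHardyLittlewood_of_dimOne
    (hR hP hH)

end Summit.Parity.GeneralizedHardyLittlewood.Theses.DeterminantMoebiusCores
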